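import Mathlib
import Summits.AtomisticToContinuum.FouriersLaw.Theses.MatthiessenLadder
import Summits.AtomisticToContinuum.FouriersLaw.Theorems.MatthiessenLadderLimitGlue
import Summits.AtomisticToContinuum.FouriersLaw.Theorems.MatthiessenLadderPrefixSteadyStatesStubHarmonicNessUnique

/-!
# Stub `stub_positiveConductance_zero` of line `registered`
# (crux stmt-AtomisticToContinuum-12776, `MatthiessenLadder.PrefixIncrementBounds`)

**Positive conductance of the harmonic base of the prefix ladder.** For `ω₂, γ > 0`, `T > 0` and
`N ≥ 2`, every response coefficient `D` of the pinned HARMONIC chain `pinnedChain ω₂ 0 0 γ` (as a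
site chain) at size `N` and mean temperature `T` is `> 0`.

Proof (glue of landed fixed-`N` theory, no definitions, no named facts). Weak steady states of the
pinned harmonic chain are unique (`PrefixSteadyStates.LineRegistered.harmonicChain_nessUnique`:
Kalman local small set + LaSalle irreducibility for the constructed transition semigroup, and the
Fokker–Planck identification of weak steady states with invariant measures via Hörmander's theorem),
so every weak steady state is the Gaussian `harmonicNESS` (`isSteadyState_harmonicNESS`). Hence the
difference quotient of the total current is constant near `δ = 0` and
`D = (N - 1) · fluxCoeff ω₂ γ N` (`MatthiessenLadder.responseCoeff_harmonic_eq`), which is `> 0` for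
`N ≥ 2` (`JunctionLocality.fluxCoeff_pos`, Roy–Dhar closed form).
-/

noncomputable section

open MeasureTheory Filter Topology

namespace Summit.AtomisticToContinuum.FouriersLaw.Theorems.MatthiessenLadder.PrefixIncrementBoundsZero

open Literature.MathematicalPhysics.KineticTheory.HeatConduction
open Summit.AtomisticToContinuum.FouriersLaw.Theses.MatthiessenLadder

/-- **Stub `stub_positiveConductance_zero` — positive conductance of the harmonic base.** For
`ω₂, γ > 0`, `T > 0` and `N ≥ 2`, every response coefficient `D` of the pinned harmonic chain
`pinnedChain ω₂ 0 0 γ` (as a site chain) at `(N, T)` is `> 0`: by weak-NESS uniqueness of the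
harmonic chain every steady-state family is the Gaussian `harmonicNESS`, so
`D = (N - 1) · fluxCoeff ω₂ γ N > 0`.
[cite: BonettoLebowitzReyBellet2000, §6.2] [cite: RoyDhar2008, §2 eq. (2.8)] -/
theorem stub_positiveConductance_zero :
    ∀ ω₂ γ : ℝ, 0 < ω₂ → 0 < γ → ∀ T : ℝ, 0 < T → ∀ N : ℕ, 2 ≤ N → ∀ D : ℝ,
      (pinnedChain ω₂ 0 0 γ).toSiteChain.IsResponseCoeff N T D → 0 < D := by
  intro ω₂ γ hω hγ T hT N hN D hD
  -- weak-NESS uniqueness identifies every weak steady state with the Gaussian NESS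
  have huniq : ∀ T_L T_R : ℝ, 0 < T_L → 0 < T_R → ∀ ν : Measure (PhaseSpace N),
      (pinnedChain ω₂ 0 0 γ).IsSteadyState N T_L T_R ν → ν = harmonicNESS ω₂ γ N T_L T_R :=
    fun T_L T_R hL hR ν hν =>
      Summit.AtomisticToContinuum.FouriersLaw.Theorems.PrefixSteadyStates.LineRegistered.harmonicChain_nessUnique
        hω hγ N hL hR ν _ hν (isSteadyState_harmonicNESS hω hγ N hL hR)
  -- hence `D = (N - 1) · fluxCoeff ω₂ γ N > 0`
  rw [responseCoeff_harmonic_eq hω hγ hT huniq hD]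
  have h1 : (1 : ℝ) < (N : ℝ) := by exact_mod_cast (show 1 < N by omega)
  exact mul_pos (by linarith)
    (Summit.AtomisticToContinuum.FouriersLaw.Theorems.JunctionLocality.fluxCoeff_pos hω hγ (by omega))

end Summit.AtomisticToContinuum.FouriersLaw.Theorems.MatthiessenLadder.PrefixIncrementBoundsZero

end
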